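import Summits.CriticalPhenomena.PercolationContinuityZ3.Theorems.PercNearOneGluingNoHeavyLowerTailBlockLonelyRelay
import Summits.CriticalPhenomena.PercolationContinuityZ3.Theorems.PercNearOneGluingNoHeavyLowerTailGuardedLonelyRelay
import Literature.Probability.Percolation.TwoSetConditionalAssociation
import HarnessLib

/-!
# `NoHeavyLowerTail` (stmt-CriticalPhenomena-4575) — the guarded BLOCK lonely relay lemma
# (Kozma–Nitzan Lemma 1(ii) + Lemma 2 for disjoint blocks with increasing guards)

For `μ = prodBernoulli w` on `Fin n`, an observer `o`, a relay set `A`, a family `𝓑` of pairwise disjoint blocks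
`B ⊆ A`, and for every block an INCREASING guard `Q_B` determined by the open cluster of `A ∖ B`
(`1_{Q_B}(ω) = G_B(⋃_{t ∈ A∖B} C_t(ω))`, `G_B` monotone), write `E_B = {o ↔ B}`, `D_B = {B ↮ A ∖ B}`.  Then

  `Σ_{B ∈ 𝓑} μ(E_B ∩ D_B ∩ Q_B) ≤ max_{B ∈ 𝓑} μ(D_B ∩ Q_B)`            (`guardedBlockLonelyRelay`)

(stated with a common bound `t`).  `Q_B = everything` is `Theorems.blockLonelyRelay`; singleton blocks are
`Theorems.guardedLonelyRelay`.  This is the tool behind the "sharp route" to the cumulative isolation lemma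
(crux evidence `CIL.md` v3): with `Q_B = {y joined to ≥ j relays of A ∖ B}` it bounds
`P(C(o) ∩ A = B, |π(y)| ≥ j+1) ≤ λ_B · P(D_B ∩ Q_B)` summed over disjoint small blocks `B`.
Mechanism per block: van den Berg–Häggström–Kahn Thm 1.5 for the vertex SETS `B`, `A∖B`
(`BHK2006_twoSetConditionalAssociation.negCorrelation`) gives `μ(D_B) μ(E_B ∩ D_B ∩ Q_B) ≤ μ(E_B ∩ D_B) μ(D_B ∩ Q_B)`;
block terminal separation (`blockTerminalSeparation`) gives `μ(E_B ∩ D_B) μ(M) ≤ μ(D_B) μ(E_B ∩ M)` with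
`M` = all blocks separated from their complements; the events `E_B ∩ M` are pairwise disjoint; `μ(M) = 0` is
removed by scaling the weights (`stub_weightContinuity`).
-/

noncomputable section

namespace Summit.CriticalPhenomena.PercolationContinuityZ3.Theorems

open scoped BigOperators Classical Topology
open MeasureTheory Set Filter
open Literature.Probability.LatticeModels (prodBernoulli)
open Literature.Probability.Percolation
open BlockLonelyRelay

variable {n : ℕ}

namespace GuardedBlockLonelyRelay

/-- The indicator of "`o` lies in the cluster of the set `B`" as a monotone function of an edge set. [folklore] -/
theorem joinFn_monotone (B : Finset (Fin n)) (o : Fin n) :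
    Monotone fun C : Set (Sym2 (Fin n)) =>
      (if (o ∈ (↑B : Set (Fin n)) ∨ ∃ e ∈ C, o ∈ e) then (1 : ℝ) else 0) := by
  intro C C' hCC'
  dsimp only
  by_cases h : (o ∈ (↑B : Set (Fin n)) ∨ ∃ e ∈ C, o ∈ e)
  · have h' : (o ∈ (↑B : Set (Fin n)) ∨ ∃ e ∈ C', o ∈ e) :=
      h.imp id fun ⟨e, he, hoe⟩ => ⟨e, hCC' he, hoe⟩
    rw [if_pos h, if_pos h']
  · rw [if_neg h]; split_ifs <;> norm_num

/-- Evaluated at `⋃_{s ∈ B} C_s`, the join function is the indicator of `E_B = {∃ b ∈ B, o ↔ b}`. [folklore] -/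
theorem joinFn_biUnion_openEdgeCluster (B : Finset (Fin n)) (o : Fin n) (ω : BondConfig (Fin n)) :
    (if (o ∈ (↑B : Set (Fin n)) ∨ ∃ e ∈ ⋃ s ∈ (↑B : Set (Fin n)), openEdgeCluster ω s, o ∈ e)
        then (1 : ℝ) else 0) =
      ({ω' : BondConfig (Fin n) | ∃ b ∈ B, ω' ∈ openConn o b}).indicator 1 ω := by
  have key : (o ∈ (↑B : Set (Fin n)) ∨ ∃ e ∈ ⋃ s ∈ (↑B : Set (Fin n)), openEdgeCluster ω s, o ∈ e) ↔
      ω ∈ {ω' : BondConfig (Fin n) | ∃ b ∈ B, ω' ∈ openConn o b} := by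
    simp only [mem_setOf_eq, mem_iUnion, exists_prop, Finset.mem_coe]
    constructor
    · rintro (ho | ⟨e, ⟨s, hs, he⟩, hoe⟩)
      · exact ⟨o, ho, (SimpleGraph.Reachable.refl o : (openGraph ω).Reachable o o)⟩
      · exact ⟨s, hs, (((mem_openEdgeCluster_iff ω s e).1 he).2.2 o hoe).symm⟩
    · rintro ⟨b, hb, hob⟩
      rcases (reachable_iff_exists_mem_openEdgeCluster ω b o).1
          (SimpleGraph.Reachable.symm (hob : (openGraph ω).Reachable o b)) with hob' | ⟨e, he, hoe⟩
      · exact Or.inl (hob' ▸ hb)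
      · exact Or.inr ⟨e, ⟨b, hb, he⟩, hoe⟩
  by_cases h : ω ∈ {ω' : BondConfig (Fin n) | ∃ b ∈ B, ω' ∈ openConn o b}
  · rw [indicator_of_mem h, Pi.one_apply, if_pos (key.2 h)]
  · rw [indicator_of_notMem h, if_neg (fun h' => h (key.1 h'))]

/-- **KN Lemma 1(ii) for a block** (negative correlation across `{B ↮ A∖B}`): for an increasing guard `Q`
determined by the cluster of `A ∖ B`, `μ(D_B) μ(E_B ∩ D_B ∩ Q) ≤ μ(E_B ∩ D_B) μ(D_B ∩ Q)`.
[cite: KozmaNitzan2024, Lemma 1(ii) (p. 5); VandenbergHaggstromKahn2005, Thm. 1.5 (sets)] -/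
theorem negCorr (w : Sym2 (Fin n) → unitInterval) (A B : Finset (Fin n)) (o : Fin n)
    (Q : Set (BondConfig (Fin n))) (G : Set (Sym2 (Fin n)) → ℝ) (hG : Monotone G)
    (hGQ : ∀ ω, G (⋃ t ∈ (↑(A \ B) : Set (Fin n)), openEdgeCluster ω t) = Q.indicator 1 ω) :
    (prodBernoulli w).real {ω | ∀ b ∈ B, ∀ a ∈ A \ B, ω ∉ openConn b a} *
        (prodBernoulli w).real ({ω | ∃ b ∈ B, ω ∈ openConn o b} ∩
          {ω | ∀ b ∈ B, ∀ a ∈ A \ B, ω ∉ openConn b a} ∩ Q) ≤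
      (prodBernoulli w).real ({ω | ∃ b ∈ B, ω ∈ openConn o b} ∩
          {ω | ∀ b ∈ B, ∀ a ∈ A \ B, ω ∉ openConn b a}) *
        (prodBernoulli w).real ({ω | ∀ b ∈ B, ∀ a ∈ A \ B, ω ∉ openConn b a} ∩ Q) := by
  have key := BHK2006_twoSetConditionalAssociation.negCorrelation w (↑B : Set (Fin n))
    (↑(A \ B) : Set (Fin n)) _ G (joinFn_monotone B o) hG
  have hD : {ω : BondConfig (Fin n) | ∀ s ∈ (↑B : Set (Fin n)), ∀ t ∈ (↑(A \ B) : Set (Fin n)),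
      ¬ (openGraph ω).Reachable s t} = {ω | ∀ b ∈ B, ∀ a ∈ A \ B, ω ∉ openConn b a} := by
    ext ω
    simp only [mem_setOf_eq, Finset.mem_coe]
    rfl
  simp only [hD, joinFn_biUnion_openEdgeCluster, hGQ] at key
  rw [TripodExchange.setIntegral_indicator_mul_indicator_eq, TripodExchange.setIntegral_indicator_one_eq,
    TripodExchange.setIntegral_indicator_one_eq] at key
  have e1 : ({ω | ∃ b ∈ B, ω ∈ openConn o b} ∩ {ω | ∀ b ∈ B, ∀ a ∈ A \ B, ω ∉ openConn b a} ∩ Q :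
      Set (BondConfig (Fin n))) =
      {ω | ∀ b ∈ B, ∀ a ∈ A \ B, ω ∉ openConn b a} ∩ ({ω | ∃ b ∈ B, ω ∈ openConn o b} ∩ Q) := by
    rw [inter_comm {ω | ∃ b ∈ B, ω ∈ openConn o b}, inter_assoc]
  have e2 : ({ω | ∃ b ∈ B, ω ∈ openConn o b} ∩ {ω | ∀ b ∈ B, ∀ a ∈ A \ B, ω ∉ openConn b a} :
      Set (BondConfig (Fin n))) =
      {ω | ∀ b ∈ B, ∀ a ∈ A \ B, ω ∉ openConn b a} ∩ {ω | ∃ b ∈ B, ω ∈ openConn o b} := inter_comm _ _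
  rw [e1, e2]
  exact key

/-- **Guarded block lonely relay bound when `μ(M) > 0`.** [cite: KozmaNitzan2024, Lemmas 1–2 (pp. 5–6)] -/
theorem guardedBlockLonelyRelay_of_pos (w : Sym2 (Fin n) → unitInterval) (A : Finset (Fin n)) (o : Fin n)
    (𝓑 : Finset (Finset (Fin n))) (hsub : ∀ B ∈ 𝓑, B ⊆ A)
    (hdisj : ∀ B' ∈ 𝓑, ∀ B'' ∈ 𝓑, B' ≠ B'' → Disjoint B' B'')
    (Q : Finset (Fin n) → Set (BondConfig (Fin n)))
    (hQ : ∀ B ∈ 𝓑, ∃ G : Set (Sym2 (Fin n)) → ℝ, Monotone G ∧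
      ∀ ω, G (⋃ t ∈ (↑(A \ B) : Set (Fin n)), openEdgeCluster ω t) = (Q B).indicator 1 ω)
    (t : ℝ) (ht : 0 ≤ t)
    (hq : ∀ B ∈ 𝓑, (prodBernoulli w).real ({ω | ∀ b ∈ B, ∀ a ∈ A \ B, ω ∉ openConn b a} ∩ Q B) ≤ t)
    (hM : 0 < (prodBernoulli w).real {ω | ∀ B' ∈ 𝓑, ∀ b ∈ B', ∀ a ∈ A \ B', ω ∉ openConn b a}) :
    ∑ B ∈ 𝓑, (prodBernoulli w).real ({ω | ∃ b ∈ B, ω ∈ openConn o b} ∩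
        {ω | ∀ b ∈ B, ∀ a ∈ A \ B, ω ∉ openConn b a} ∩ Q B) ≤ t := by
  set μ := prodBernoulli w with hμ
  set M : Set (BondConfig (Fin n)) := {ω | ∀ B' ∈ 𝓑, ∀ b ∈ B', ∀ a ∈ A \ B', ω ∉ openConn b a} with hMdef
  have h2 : ∀ B ∈ 𝓑,
      μ.real ({ω | ∃ b ∈ B, ω ∈ openConn o b} ∩ {ω | ∀ b ∈ B, ∀ a ∈ A \ B, ω ∉ openConn b a} ∩ Q B) *
          μ.real M ≤ t * μ.real ({ω | ∃ b ∈ B, ω ∈ openConn o b} ∩ M) := by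
    intro B hB
    obtain ⟨G, hG, hGQ⟩ := hQ B hB
    have hneg := negCorr w A B o (Q B) G hG hGQ
    -- terminal separation with `T = A \\ B`, pair set of the other blocks
    have hP : ∀ p ∈ (𝓑.erase B).biUnion (fun B' => B' ×ˢ (A \ (B' ∪ B))), p.1 ∈ A \ B := by
      intro p hp
      obtain ⟨B', hB', hne, h1, _, _, _⟩ := mem_pairs_iff.1 hp
      exact Finset.mem_sdiff.2 ⟨hsub B' hB' h1,
        fun h => (Finset.disjoint_left.1 (hdisj B' hB' B hB hne)) h1 h⟩
    have hsep := blockTerminalSeparation w B (A \ B) o _ hP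
    rw [sep_inter_pairs_eq hB hsub hdisj] at hsep
    have hqB := hq B hB
    set D : Set (BondConfig (Fin n)) := {ω | ∀ b ∈ B, ∀ a ∈ A \ B, ω ∉ openConn b a} with hD
    set E : Set (BondConfig (Fin n)) := {ω | ∃ b ∈ B, ω ∈ openConn o b} with hE
    set g := μ.real (E ∩ D ∩ Q B) with hg
    set d := μ.real D with hd
    set e := μ.real (E ∩ D) with he
    set m := μ.real M with hm
    set f := μ.real (E ∩ M) with hf
    have hg0 : 0 ≤ g := measureReal_nonneg
    have hm0 : 0 ≤ m := measureReal_nonneg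
    have hf0 : 0 ≤ f := measureReal_nonneg
    have he0 : 0 ≤ e := measureReal_nonneg
    have hgd : g ≤ d := measureReal_mono (fun ω hω => hω.1.2)
    rcases (measureReal_nonneg : 0 ≤ d).eq_or_lt with hd0 | hdpos
    · have hg' : g = 0 := le_antisymm (hd0 ▸ hgd) hg0
      rw [hg', zero_mul]
      exact mul_nonneg ht hf0
    · have h1 : d * g * m ≤ e * t * m :=
        mul_le_mul_of_nonneg_right (hneg.trans (mul_le_mul_of_nonneg_left hqB he0)) hm0
      have h3 : e * t * m ≤ d * f * t := by
        calc e * t * m = e * m * t := by ring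
          _ ≤ d * f * t := mul_le_mul_of_nonneg_right hsep ht
      have h4 : d * (g * m) ≤ d * (t * f) := by
        calc d * (g * m) = d * g * m := by ring
          _ ≤ d * f * t := h1.trans h3
          _ = d * (t * f) := by ring
      exact le_of_mul_le_mul_left h4 hdpos
  have h3 : ∑ B ∈ 𝓑, μ.real ({ω | ∃ b ∈ B, ω ∈ openConn o b} ∩ M) ≤ μ.real M := by
    rw [← measureReal_biUnion_finset (pairwiseDisjoint_join_inter 𝓑 o hsub hdisj)
      (fun B _ => MeasurableSet.of_discrete)]
    exact measureReal_mono (Set.iUnion₂_subset fun B _ => Set.inter_subset_right)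
  have h4 : (∑ B ∈ 𝓑, μ.real ({ω | ∃ b ∈ B, ω ∈ openConn o b} ∩
      {ω | ∀ b ∈ B, ∀ a ∈ A \ B, ω ∉ openConn b a} ∩ Q B)) * μ.real M ≤ t * μ.real M := by
    rw [Finset.sum_mul]
    calc ∑ B ∈ 𝓑, μ.real ({ω | ∃ b ∈ B, ω ∈ openConn o b} ∩
            {ω | ∀ b ∈ B, ∀ a ∈ A \ B, ω ∉ openConn b a} ∩ Q B) * μ.real M
        ≤ ∑ B ∈ 𝓑, t * μ.real ({ω | ∃ b ∈ B, ω ∈ openConn o b} ∩ M) := Finset.sum_le_sum h2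
      _ = t * ∑ B ∈ 𝓑, μ.real ({ω | ∃ b ∈ B, ω ∈ openConn o b} ∩ M) := (Finset.mul_sum _ _ _).symm
      _ ≤ t * μ.real M := mul_le_mul_of_nonneg_left h3 ht
  exact le_of_mul_le_mul_right h4 hM

end GuardedBlockLonelyRelay

open GuardedBlockLonelyRelay in
/-- **The guarded block lonely relay lemma (KN Lemma 1(ii) + Lemma 2 for blocks), unconditional.**  For
`μ = prodBernoulli w` on `Fin n`, an observer `o`, a relay set `A`, pairwise disjoint blocks `B ∈ 𝓑`, `B ⊆ A`,
increasing guards `Q_B` determined by the cluster of `A ∖ B` (`1_{Q_B}(ω) = G_B(⋃_{t∈A∖B} C_t ω)`, `G_B`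
monotone), and `t ≥ 0` with `μ({B ↮ A∖B} ∩ Q_B) ≤ t` for every block:
`Σ_{B∈𝓑} μ({o ↔ B} ∩ {B ↮ A∖B} ∩ Q_B) ≤ t`.
[cite: KozmaNitzan2024, Lemmas 1–2 (pp. 5–6); VandenbergHaggstromKahn2005, Thms. 1.3, 1.5] -/
theorem guardedBlockLonelyRelay (w : Sym2 (Fin n) → unitInterval) (A : Finset (Fin n)) (o : Fin n)
    (𝓑 : Finset (Finset (Fin n))) (hsub : ∀ B ∈ 𝓑, B ⊆ A)
    (hdisj : ∀ B' ∈ 𝓑, ∀ B'' ∈ 𝓑, B' ≠ B'' → Disjoint B' B'')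
    (Q : Finset (Fin n) → Set (BondConfig (Fin n)))
    (hQ : ∀ B ∈ 𝓑, ∃ G : Set (Sym2 (Fin n)) → ℝ, Monotone G ∧
      ∀ ω, G (⋃ t ∈ (↑(A \ B) : Set (Fin n)), openEdgeCluster ω t) = (Q B).indicator 1 ω)
    (t : ℝ) (ht : 0 ≤ t)
    (hq : ∀ B ∈ 𝓑, (prodBernoulli w).real ({ω | ∀ b ∈ B, ∀ a ∈ A \ B, ω ∉ openConn b a} ∩ Q B) ≤ t) :
    ∑ B ∈ 𝓑, (prodBernoulli w).real ({ω | ∃ b ∈ B, ω ∈ openConn o b} ∩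
        {ω | ∀ b ∈ B, ∀ a ∈ A \ B, ω ∉ openConn b a} ∩ Q B) ≤ t := by
  -- scaled weights `w_k = (1 - 1/(k+1)) • w`, all `< 1`, converging to `w`
  have hcmem : ∀ k : ℕ, ((1 : ℝ) - 1 / ((k : ℝ) + 1)) ∈ unitInterval := by
    intro k
    have hk : (0 : ℝ) < (k : ℝ) + 1 := Nat.cast_add_one_pos k
    have h1 : 1 / ((k : ℝ) + 1) ≤ 1 := by
      rw [div_le_one hk]; linarith [(Nat.cast_nonneg k : (0 : ℝ) ≤ k)]
    have h0 : 0 ≤ 1 / ((k : ℝ) + 1) := by positivity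
    exact ⟨by linarith, by linarith⟩
  set wk : ℕ → Sym2 (Fin n) → unitInterval :=
    fun k e => ⟨(1 - 1 / ((k : ℝ) + 1)) * (w e : ℝ), unitInterval.mul_mem (hcmem k) (w e).2⟩
    with hwk_def
  have hwk_lt : ∀ k e, ((wk k e : unitInterval) : ℝ) < 1 := by
    intro k e
    have hk : (0 : ℝ) < (k : ℝ) + 1 := Nat.cast_add_one_pos k
    have hc : (1 : ℝ) - 1 / ((k : ℝ) + 1) < 1 := by
      have : 0 < 1 / ((k : ℝ) + 1) := by positivity
      linarith
    calc ((wk k e : unitInterval) : ℝ) = (1 - 1 / ((k : ℝ) + 1)) * (w e : ℝ) := rfl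
      _ ≤ (1 - 1 / ((k : ℝ) + 1)) := mul_le_of_le_one_right (hcmem k).1 (w e).2.2
      _ < 1 := hc
  have hc_lim : Tendsto (fun k : ℕ => (1 : ℝ) - 1 / ((k : ℝ) + 1)) atTop (𝓝 1) := by
    simpa using tendsto_const_nhds.sub (tendsto_one_div_add_atTop_nhds_zero_nat (𝕜 := ℝ))
  have hwk_lim : Tendsto wk atTop (𝓝 w) := by
    refine tendsto_pi_nhds.2 fun e => ?_
    rw [tendsto_subtype_rng]
    have h := hc_lim.mul_const (w e : ℝ)
    rw [one_mul] at h
    exact h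
  have hlimE : ∀ E : Set (Set (Sym2 (Fin n))),
      Tendsto (fun k => (prodBernoulli (wk k)).real E) atTop (𝓝 ((prodBernoulli w).real E)) :=
    fun E => ((stub_weightContinuity n E).tendsto w).comp hwk_lim
  set δ : ℕ → ℝ := fun k => ∑ B ∈ 𝓑,
      |(prodBernoulli (wk k)).real ({ω | ∀ b ∈ B, ∀ a ∈ A \ B, ω ∉ openConn b a} ∩ Q B) -
        (prodBernoulli w).real ({ω | ∀ b ∈ B, ∀ a ∈ A \ B, ω ∉ openConn b a} ∩ Q B)| with hδ_def
  have hδ0 : ∀ k, 0 ≤ δ k := fun k => Finset.sum_nonneg fun B _ => abs_nonneg _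
  have hδ_lim : Tendsto δ atTop (𝓝 0) := by
    have h : ∀ B ∈ 𝓑, Tendsto (fun k =>
        |(prodBernoulli (wk k)).real ({ω | ∀ b ∈ B, ∀ a ∈ A \ B, ω ∉ openConn b a} ∩ Q B) -
          (prodBernoulli w).real ({ω | ∀ b ∈ B, ∀ a ∈ A \ B, ω ∉ openConn b a} ∩ Q B)|) atTop (𝓝 0) := by
      intro B _
      simpa using (tendsto_sub_nhds_zero_iff.2
        (hlimE ({ω | ∀ b ∈ B, ∀ a ∈ A \ B, ω ∉ openConn b a} ∩ Q B))).abs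
    simpa [hδ_def] using tendsto_finsetSum 𝓑 h
  have hk : ∀ k, ∑ B ∈ 𝓑, (prodBernoulli (wk k)).real ({ω | ∃ b ∈ B, ω ∈ openConn o b} ∩
      {ω | ∀ b ∈ B, ∀ a ∈ A \ B, ω ∉ openConn b a} ∩ Q B) ≤ t + δ k := by
    intro k
    refine guardedBlockLonelyRelay_of_pos (wk k) A o 𝓑 hsub hdisj Q hQ (t + δ k) (by linarith [hδ0 k]) ?_ ?_
    · intro B hB
      have h1 := hq B hB
      have h2 : |(prodBernoulli (wk k)).real ({ω | ∀ b ∈ B, ∀ a ∈ A \ B, ω ∉ openConn b a} ∩ Q B) -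
            (prodBernoulli w).real ({ω | ∀ b ∈ B, ∀ a ∈ A \ B, ω ∉ openConn b a} ∩ Q B)| ≤ δ k :=
        Finset.single_le_sum (f := fun B =>
          |(prodBernoulli (wk k)).real ({ω | ∀ b ∈ B, ∀ a ∈ A \ B, ω ∉ openConn b a} ∩ Q B) -
            (prodBernoulli w).real ({ω | ∀ b ∈ B, ∀ a ∈ A \ B, ω ∉ openConn b a} ∩ Q B)|)
          (fun B _ => abs_nonneg _) hB
      have h3 := le_abs_self
        ((prodBernoulli (wk k)).real ({ω | ∀ b ∈ B, ∀ a ∈ A \ B, ω ∉ openConn b a} ∩ Q B) -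
          (prodBernoulli w).real ({ω | ∀ b ∈ B, ∀ a ∈ A \ B, ω ∉ openConn b a} ∩ Q B))
      linarith
    · exact lt_of_lt_of_le (singleFinger_pairSep_real_pos (wk k) (hwk_lt k) A)
        (measureReal_mono (sepAll_subset_M A 𝓑 hsub hdisj))
  have hlimS : Tendsto (fun k => ∑ B ∈ 𝓑, (prodBernoulli (wk k)).real ({ω | ∃ b ∈ B, ω ∈ openConn o b} ∩
      {ω | ∀ b ∈ B, ∀ a ∈ A \ B, ω ∉ openConn b a} ∩ Q B)) atTop
      (𝓝 (∑ B ∈ 𝓑, (prodBernoulli w).real ({ω | ∃ b ∈ B, ω ∈ openConn o b} ∩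
        {ω | ∀ b ∈ B, ∀ a ∈ A \ B, ω ∉ openConn b a} ∩ Q B))) :=
    tendsto_finsetSum 𝓑 fun B _ => hlimE _
  have hlimt : Tendsto (fun k => t + δ k) atTop (𝓝 t) := by
    simpa using tendsto_const_nhds.add hδ_lim
  exact le_of_tendsto_of_tendsto' hlimS hlimt hk

end Summit.CriticalPhenomena.PercolationContinuityZ3.Theorems

end
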